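import Summits.Parity.BatemanHorn.Theorems.SoloInformedErdosNairClassI

/-!
# Erdős's bound `∑_{n ≤ N} τ(|g(n)|) ≪ N log N`: Shiu's class III for polynomial values

Solo informed line (Parity / Bateman–Horn), session 139 — fifth file of the unconditional proof of
Erdős's bound (discharging the Nair–Tenenbaum hypothesis of `SoloInformedErdosUpperBoundNT`);
notation as in `SoloInformedErdosNairClassI` (`m_n = |g(n)| = c_n d_n` cut at height `z = w²`, cut
prime `P_n`).  Class III consists of the `n ≤ N` with `m_n > z`, `P_n ≤ L` and `c_n > w`: then
`c = c_n ∈ (w, z]` has all its prime factors `< L`, the fibre `{c_n = c}` lies in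
`{n ≤ N : c ∣ g(n)}` (at most `ρ_g(c)(N/c + 1)` elements, `card_Icc_filter_dvd_eval_le`), and
`ρ_g(c)(N/c + 1) ≤ (N + z) · h_g(c)/c` with the Erdős–Nair weight
`h_g(c) = τ(c)ρ_g(c)∏_{p∣c}(1 − ρ_g(p)/p)⁻¹`, whose Rankin sum over `c > w` with prime factors `< L`
is `≤ K w^{−1/6} e^{B L^{1/6} log(4L)/6} P_g(L)⁻²` (`exists_weightSum_rankin_le`, `η = 1/6`,
`B = 2W(1+D)`).  With `τ(m_n) ≤ F` on `[1, N]`: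

* `polyClassIII_bound` —
  `∑_{III} τ(m_n) ≤ F K (N + z) w^{−1/6} exp(2W(1+D)·(1/6)·L^{1/6}(log L + log 4)) (∏_{p<L}(1 − ρ_g(p)/p))⁻²`.

Uniform in `g` with `ρ_g(p) ≤ D`, `ρ_g(p) < p`, `ρ_g(p^a) ≤ W`.  Everything is PROVED; no
definitions, no named facts.  Class IV and the assembly follow.

References: P. Shiu, J. reine angew. Math. 313 (1980) 161–170, §5 (`∑_{III}`) [Shiu1980]; P. Erdős,
J. London Math. Soc. 27 (1952) 7–15 [Erdos1952]; M. Nair, Acta Arith. 62 (1992) 257–269 [Nair1992].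
-/

open Finset Real Polynomial

namespace Summit.Parity.BatemanHorn.Theorems

open Literature.NumberTheory.Sieve

namespace ErdosDivisor

/-- `ρ_g(c)/c ≤ h_g(c)/c` for `c ≠ 0` (`τ(c) ≥ 1`, `∏_{p∣c}(1 − ρ_g(p)/p)⁻¹ ≥ 1`). [folklore] -/
theorem rho_div_le_weight_div {g : ℤ[X]} (hg : HasNoFixedPrimeDivisor ![g]) {c : ℕ} (hc : c ≠ 0) :
    (polyRootCountMod ![g] c : ℝ) / c ≤
      (#c.divisors : ℝ) * (polyRootCountMod ![g] c : ℝ) *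
        (∏ p ∈ c.primeFactors, (1 - (polyRootCountMod ![g] p : ℝ) / p)⁻¹) / c := by
  have hτ : (1 : ℝ) ≤ #c.divisors := by
    exact_mod_cast card_pos.2 ⟨1, Nat.one_mem_divisors.2 hc⟩
  have hE := one_le_prod_inv_one_sub_rho hg c
  have hρ : (0 : ℝ) ≤ polyRootCountMod ![g] c := Nat.cast_nonneg _
  refine div_le_div_of_nonneg_right ?_ (Nat.cast_nonneg c)
  calc (polyRootCountMod ![g] c : ℝ) = 1 * polyRootCountMod ![g] c * 1 := by ring
    _ ≤ (#c.divisors : ℝ) * polyRootCountMod ![g] c *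
        ∏ p ∈ c.primeFactors, (1 - (polyRootCountMod ![g] p : ℝ) / p)⁻¹ :=
        mul_le_mul (mul_le_mul_of_nonneg_right hτ hρ) hE zero_le_one (by positivity)

/-- The fibre `{n ≤ N : c_n = c}` (any `z`) lies in `{n ≤ N : c ∣ g(n)}`, hence has at most
`ρ_g(c)(N/c + 1)` elements (`card_Icc_filter_dvd_eval_le`). [folklore] -/
theorem card_fiber_cPart_le (g : ℤ[X]) (N : ℕ) (z : ℝ) {c : ℕ} (hc : 0 < c) (T : Finset ℕ)
    (hT : T ⊆ Icc 1 N) (hT0 : ∀ n ∈ T, (g.eval (n : ℤ)).natAbs ≠ 0) :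
    (#(T.filter fun n : ℕ => Shiu.cPart z (g.eval (n : ℤ)).natAbs = c) : ℝ) ≤
      polyRootCountMod ![g] c * ((N : ℝ) / c + 1) := by
  refine le_trans ?_ (card_Icc_filter_dvd_eval_le g hc N)
  exact_mod_cast card_le_card fun n hn => by
    rw [mem_filter] at hn ⊢
    exact ⟨hT hn.1, Int.natCast_dvd.2 (hn.2 ▸ Shiu.cPart_dvd (hT0 n hn.1))⟩

/-- **Class III** (the polynomial analogue of Shiu 1980, §5, `∑_{III}`).  Let `ρ_g(p) ≤ D`,
`ρ_g(p) < p`, `ρ_g(p^a) ≤ W` (`W ≥ 1`) at every prime.  There is `K = K(g) > 0` such that for all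
`N`, `w ≥ 2`, `z = w²`, `L ≥ 2`, `F ≥ 0` with `τ(|g(n)|) ≤ F` on `[1, N]`:
`∑_{n ≤ N, |g(n)| > z, P_n ≤ L, c_n > w} τ(|g(n)|)`
`≤ F K (N + z) w^{−1/6} exp(2W(1+D)(1/6)L^{1/6}(log L + log 4)) (∏_{p<L}(1 − ρ_g(p)/p))⁻²`.
[cite: Shiu1980, §5 (∑_III)]; [this work] -/
theorem polyClassIII_bound {g : ℤ[X]} (hg : HasNoFixedPrimeDivisor ![g]) {D : ℕ} {W : ℝ}
    (hD : ∀ p : ℕ, p.Prime → polyRootCountMod ![g] p ≤ D)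
    (hW : ∀ p : ℕ, p.Prime → ∀ a : ℕ, (polyRootCountMod ![g] (p ^ a) : ℝ) ≤ W) (hW1 : 1 ≤ W) :
    ∃ K : ℝ, 0 < K ∧ ∀ (N : ℕ) (z w L F : ℝ), 2 ≤ w → w * w = z → 2 ≤ L → 0 ≤ F →
      (∀ n ∈ Icc 1 N, (#((g.eval (n : ℤ)).natAbs.divisors) : ℝ) ≤ F) →
        ∑ n ∈ (Icc 1 N).filter (fun n : ℕ => z < (((g.eval (n : ℤ)).natAbs : ℕ) : ℝ) ∧
            (Shiu.cutPrime z (g.eval (n : ℤ)).natAbs : ℝ) ≤ L ∧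
            w < (Shiu.cPart z (g.eval (n : ℤ)).natAbs : ℝ)),
            (#((g.eval (n : ℤ)).natAbs.divisors) : ℝ) ≤
          F * K * ((N : ℝ) + z) * w ^ (-(1 / 6 : ℝ)) *
            Real.exp (2 * W * (1 + D) * (1 / 6) * L ^ (1 / 6 : ℝ) * (Real.log L + Real.log 4)) *
            ((∏ p ∈ Nat.primesBelow ⌈L⌉₊, (1 - (polyRootCountMod ![g] p : ℝ) / p)) ^ 2)⁻¹ := by
  classical
  obtain ⟨K, hK, hR⟩ := exists_weightSum_rankin_le hg hD hW hW1
  refine ⟨K, hK, fun N z w L F hw hwz hL hF0 hF => ?_⟩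
  set ρ : ℕ → ℝ := fun c => (polyRootCountMod ![g] c : ℝ) with hρ
  set E : ℕ → ℝ := fun c => ∏ p ∈ c.primeFactors, (1 - (polyRootCountMod ![g] p : ℝ) / p)⁻¹ with hE
  set PL : ℝ := ∏ p ∈ Nat.primesBelow ⌈L⌉₊, (1 - (polyRootCountMod ![g] p : ℝ) / p) with hPL
  set X₆ : ℝ := Real.exp (2 * W * (1 + D) * (1 / 6) * L ^ (1 / 6 : ℝ) * (Real.log L + Real.log 4))
    with hX₆
  set T := (Icc 1 N).filter (fun n : ℕ => z < (((g.eval (n : ℤ)).natAbs : ℕ) : ℝ) ∧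
      (Shiu.cutPrime z (g.eval (n : ℤ)).natAbs : ℝ) ≤ L ∧
      w < (Shiu.cPart z (g.eval (n : ℤ)).natAbs : ℝ)) with hT
  set C := (Icc 1 ⌊z⌋₊).filter (fun c : ℕ => w < (c : ℝ) ∧ ∀ p ∈ c.primeFactors, (p : ℝ) < L)
    with hC
  have hw0 : 0 < w := by linarith
  have hz1 : 1 ≤ z := by nlinarith
  have hz0 : 0 ≤ z := by linarith
  -- facts about `n ∈ T`
  have hTmem : ∀ n ∈ T, n ∈ Icc 1 N ∧ z < (((g.eval (n : ℤ)).natAbs : ℕ) : ℝ) ∧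
      (Shiu.cutPrime z (g.eval (n : ℤ)).natAbs : ℝ) ≤ L ∧
      w < (Shiu.cPart z (g.eval (n : ℤ)).natAbs : ℝ) := fun n hn => by
    simpa only [hT, mem_filter, and_assoc] using hn
  have hm2 : ∀ n ∈ T, 2 ≤ (g.eval (n : ℤ)).natAbs := fun n hn =>
    two_le_natAbs_of_lt hz1 (hTmem n hn).2.1
  have hm0 : ∀ n ∈ T, (g.eval (n : ℤ)).natAbs ≠ 0 := fun n hn => by have := hm2 n hn; omega
  -- Step 1: `∑ τ ≤ F #T`
  have h1 : ∑ n ∈ T, (#((g.eval (n : ℤ)).natAbs.divisors) : ℝ) ≤ F * #T := by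
    calc ∑ n ∈ T, (#((g.eval (n : ℤ)).natAbs.divisors) : ℝ) ≤ ∑ n ∈ T, F :=
          sum_le_sum fun n hn => hF n (mem_filter.1 hn).1
      _ = F * #T := by rw [sum_const, nsmul_eq_mul, mul_comm]
  refine h1.trans ?_
  -- Step 2: the fibres over `c ∈ C`
  have hmaps : (T : Set ℕ).MapsTo (fun n : ℕ => Shiu.cPart z (g.eval (n : ℤ)).natAbs) C := by
    intro n hn
    have hn' := mem_coe.1 hn
    obtain ⟨-, -, hPL', hcw⟩ := hTmem n hn'
    rw [mem_coe, hC, mem_filter, mem_Icc]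
    refine ⟨⟨Nat.one_le_iff_ne_zero.2 Shiu.cPart_ne_zero,
      Nat.le_floor (Shiu.cutPrime_mem (hm2 n hn') hz1).2⟩, hcw, fun p hp => ?_⟩
    have h1 := Shiu.lt_of_mem_primeFactors_cPart hp
    exact lt_of_lt_of_le (by exact_mod_cast h1) hPL'
  rw [card_eq_sum_card_fiberwise hmaps]
  push_cast
  -- Step 3: each fibre
  have hfib : ∀ c ∈ C,
      (#(T.filter fun n : ℕ => Shiu.cPart z (g.eval (n : ℤ)).natAbs = c) : ℝ) ≤
        ((N : ℝ) + z) * ((#c.divisors : ℝ) * ρ c * E c / c) := by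
    intro c hc
    rw [hC, mem_filter, mem_Icc] at hc
    obtain ⟨⟨hc1, hcz⟩, -, -⟩ := hc
    have hc0 : c ≠ 0 := by omega
    have hc0' : (0 : ℝ) < c := by exact_mod_cast hc1
    have hcz' : (c : ℝ) ≤ z := (Nat.le_floor_iff hz0).1 hcz
    have hcard := card_fiber_cPart_le g N z hc1 T (filter_subset _ _) hm0
    have hdiv := rho_div_le_weight_div hg hc0
    have hh0 : 0 ≤ (#c.divisors : ℝ) * ρ c * E c / c := le_trans (by positivity) hdiv
    calc (#(T.filter fun n : ℕ => Shiu.cPart z (g.eval (n : ℤ)).natAbs = c) : ℝ)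
        ≤ ρ c * ((N : ℝ) / c + 1) := hcard
      _ = ((N : ℝ) + c) * (ρ c / c) := by field_simp
      _ ≤ ((N : ℝ) + z) * ((#c.divisors : ℝ) * ρ c * E c / c) :=
          mul_le_mul (by linarith) hdiv (div_nonneg (Nat.cast_nonneg _) hc0'.le) (by positivity)
  -- Step 4: Rankin's trick with `η = 1/6`
  have hRankin := hR (1 / 6) (by norm_num) le_rfl L w hL hw0 C
    (fun c hc => by have := (mem_Icc.1 (mem_filter.1 hc).1).1; omega)
    (fun c hc => ((mem_filter.1 hc).2.1).le)
    (fun c hc p hp => (mem_filter.1 hc).2.2 p hp)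
  have hNz : 0 ≤ (N : ℝ) + z := by positivity
  calc F * ∑ c ∈ C, (#(T.filter fun n : ℕ => Shiu.cPart z (g.eval (n : ℤ)).natAbs = c) : ℝ)
      ≤ F * ∑ c ∈ C, ((N : ℝ) + z) * ((#c.divisors : ℝ) * ρ c * E c / c) :=
        mul_le_mul_of_nonneg_left (sum_le_sum hfib) hF0
    _ = F * (((N : ℝ) + z) * ∑ c ∈ C, (#c.divisors : ℝ) * ρ c * E c / c) := by rw [← mul_sum]
    _ ≤ F * (((N : ℝ) + z) * (K * w ^ (-(1 / 6 : ℝ)) * X₆ * (PL ^ 2)⁻¹)) :=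
        mul_le_mul_of_nonneg_left (mul_le_mul_of_nonneg_left hRankin hNz) hF0
    _ = F * K * ((N : ℝ) + z) * w ^ (-(1 / 6 : ℝ)) * X₆ * (PL ^ 2)⁻¹ := by ring

end ErdosDivisor

end Summit.Parity.BatemanHorn.Theorems
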